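import Summits.AtomisticToContinuum.Crystallization.Theorems.IsometryAtomsMinimisingLawsHaveAtomsEnergyTransitive
import Summits.AtomisticToContinuum.Crystallization.Theorems.LayeredLawsSelectHcp.Negative.PeriodicEnergy
import Literature.MathematicalPhysics.StatisticalMechanics.CrystallizationLocalLimit
import HarnessLib

/-!
# Line `perron_transfer` of crux `IsometryAtoms.MinimisingLawsHaveAtoms` (stmt-AtomisticToContinuum-15776):
# under K*, every optimal periodic configuration is ENERGY-TRANSITIVE

Helper of the lead prover (continuation c2), `--supports stmt-AtomisticToContinuum-15776`.

The landed bridge of the line (`stub_palmEnergyTransitive`, p172887) and its equality form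
(`ae_forall_rootEnergy_map_sub_eq_of_noFractionalGain`, p173208) say: under the copositive floor K*
(`PerronTransitivity.NoFractionalGain`, stmt-15098) a minimising point-stationary hard-core Lennard-Jones law has
root energy `e*` at EVERY site, almost surely. Fed with the Palm law `palmLaw Q` of a periodic configuration `Q`
(root at a uniformly chosen motif point; point-stationary by `pointStationary_palmLaw`, mean root energy `e(Q)` by
`meanRootEnergy_palmLaw`), this gives a DETERMINISTIC statement about periodic minimisers:

* `siteSum_eq_of_noFractionalGain` — K* ⇒ for every periodic configuration `Q` of `ℝ³` with `e(Q) ≤ e*`, the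
  site sum `Σ'_{q ∈ Q, q ≠ p} V_LJ(dist p q)` equals `2e*` at EVERY point `p` of `Q` (energy-transitivity: no
  optimal periodic configuration has two energetically different site classes — e.g. a dhcp/4H-type polytype
  with two site classes straddling the mean is not optimal under K*); periodic point sets are uniformly
  separated (`PeriodicConfiguration.exists_pos_le_dist`), which is all the hard core the bridge needs;
* `siteSum_eq_of_noFractionalGain_of_isLeast` — the same for every OPTIMAL periodic configuration (`IsLeast`);
* `uniformlyBound_of_noFractionalGain_of_isLeast` — hence under K* every optimal periodic point set satisfies
  the three hypotheses of M* (`PerronTransitivity.UniformBindingRigidity`, stmt-15099) verbatim: under K* the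
  class of non-empty uniformly discrete uniformly `2e*`-bound sets CONTAINS the optimal periodic point sets, and
  under K* ∧ M* the two classes coincide — so the line's isolation stub (`stub_minimisingCrystalsCountable`:
  optimal periodic point sets are countable modulo isometry) is exactly the countability modulo isometry of M*'s
  hypothesis class.
-/

noncomputable section

namespace Summit.AtomisticToContinuum.Crystallization.Theorems.IsometryAtomsMinimisingLawsHaveAtoms

open MeasureTheory Set
open Literature.MathematicalPhysics.StatisticalMechanics (lennardJones rootEnergy rootEnergy_def PeriodicConfiguration)
open Literature.Probability.Process (IsRootedHardCore IsPointStationaryLaw)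
open Summit.AtomisticToContinuum.Crystallization.Theorems.ChargedEnergyGapNegative
  (E3 eStar bddBelow_energyPerParticle_lennardJones)
open Summit.AtomisticToContinuum.Crystallization.Theorems.LayeredLawsSelectHcp.Negative.DiracLaws (meanRootEnergy)
open Summit.AtomisticToContinuum.Crystallization.Theorems.LayeredLawsSelectHcp.Negative.PeriodicPalmLaw
open Summit.AtomisticToContinuum.Crystallization.Theorems.LayeredLawsSelectHcp.Negative.PeriodicEnergy
  (meanRootEnergy_palmLaw integral_lennardJones_viewMeasure tsum_points_eq_tsum_ne)
open Summit.AtomisticToContinuum.Crystallization.Theses.PerronTransitivity (NoFractionalGain UniformBindingRigidity)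

/-- The mean root energy of the Palm law of `Q`, written with `rootEnergy`, is `e(Q)`. [folklore] -/
theorem integral_rootEnergy_palmLaw (Q : PeriodicConfiguration 3) :
    (∫ μ, rootEnergy lennardJones μ ∂(palmLaw Q)) = Q.energyPerParticle lennardJones := by
  rw [← meanRootEnergy_palmLaw Q]
  rfl

/-- The view from a point charges each of its sites: `count|(Q − x) {p − x} ≠ 0` for `p ∈ Q`. [folklore] -/
theorem viewMeasure_singleton_ne_zero (Q : PeriodicConfiguration 3) (x : E3) {p : E3} (hp : p ∈ Q.points) :
    viewMeasure Q x {p - x} ≠ 0 := by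
  have hmem : p - x ∈ view Q x := ⟨p, hp, rfl⟩
  show (Measure.count : Measure E3).restrict (view Q x) {p - x} ≠ 0
  rw [Measure.restrict_apply (measurableSet_singleton _),
    Set.inter_eq_left.2 (Set.singleton_subset_iff.2 hmem), Measure.count_singleton]
  exact one_ne_zero

/-- **K* ⇒ optimal periodic configurations are energy-transitive.** Under `NoFractionalGain`, a periodic
configuration `Q` of `ℝ³` with `e(Q) ≤ e*` has site sum `Σ'_{q ∈ Q, q ≠ p} V_LJ(dist p q) = 2e*` at every point
`p`: `Q.points` is uniformly separated, so the Palm law `palmLaw Q` is a minimising point-stationary hard-core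
law, and (`ae_forall_rootEnergy_map_sub_eq_of_noFractionalGain`) almost surely every site has root energy `e*`;
almost surely under `palmLaw Q` means at each motif view `count|(Q − x)`, whose sites are all of `Q − x`, and
`2 h(count|(Q − p))` is the site sum at `p`. [folklore] -/
theorem siteSum_eq_of_noFractionalGain (hK : NoFractionalGain) (Q : PeriodicConfiguration 3)
    (hopt : Q.energyPerParticle lennardJones ≤ eStar) :
    ∀ p ∈ Q.points, ∑' q : {q : E3 // q ∈ Q.points ∧ q ≠ p}, lennardJones (dist p q.1) = 2 * eStar := by
  intro p hp
  obtain ⟨δ, hδ, hsep⟩ := Q.exists_pos_le_dist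
  have hE : (∫ μ, rootEnergy lennardJones μ ∂(palmLaw Q)) ≤ eStar := by
    rw [integral_rootEnergy_palmLaw]
    exact hopt
  have hae := ae_forall_rootEnergy_map_sub_eq_of_noFractionalGain (P := palmLaw Q) hδ
    (rooted_palmLaw Q hsep) (pointStationary_palmLaw Q) hE hK
  obtain ⟨x₀, hx₀⟩ := Q.motif_nonempty
  have h1 := of_ae_palmLaw Q hae x₀ hx₀ (p - x₀) (viewMeasure_singleton_ne_zero Q x₀ hp)
  rw [map_sub_viewMeasure, add_sub_cancel, rootEnergy_def, integral_lennardJones_viewMeasure Q hp,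
    tsum_points_eq_tsum_ne Q hp] at h1
  linarith

/-- `e(Q) ≤ e*` makes `e(Q)` the least energy per particle. [folklore] -/
theorem isLeast_of_le_eStar (Q : PeriodicConfiguration 3) (hopt : Q.energyPerParticle lennardJones ≤ eStar) :
    IsLeast (Set.range fun Q' : PeriodicConfiguration 3 => Q'.energyPerParticle lennardJones)
      (Q.energyPerParticle lennardJones) :=
  ⟨⟨Q, rfl⟩, by
    rintro _ ⟨Q', rfl⟩
    exact hopt.trans (ciInf_le bddBelow_energyPerParticle_lennardJones Q')⟩

/-- Conversely a least energy per particle is `≤ e*` (indeed `= e*`). [folklore] -/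
theorem le_eStar_of_isLeast (Q : PeriodicConfiguration 3)
    (hleast : IsLeast (Set.range fun Q' : PeriodicConfiguration 3 => Q'.energyPerParticle lennardJones)
      (Q.energyPerParticle lennardJones)) :
    Q.energyPerParticle lennardJones ≤ eStar :=
  (le_ciInf fun Q' => hleast.2 ⟨Q', rfl⟩ : Q.energyPerParticle lennardJones ≤ eStar)

/-- **K* ⇒ every OPTIMAL periodic configuration is energy-transitive** (`IsLeast` form, conclusion with the
infimum written out as in M*). [folklore] -/
theorem siteSum_eq_of_noFractionalGain_of_isLeast (hK : NoFractionalGain) (Q : PeriodicConfiguration 3)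
    (hleast : IsLeast (Set.range fun Q' : PeriodicConfiguration 3 => Q'.energyPerParticle lennardJones)
      (Q.energyPerParticle lennardJones)) :
    ∀ p ∈ Q.points, ∑' q : {q : E3 // q ∈ Q.points ∧ q ≠ p}, lennardJones (dist p q.1) =
      2 * ⨅ Q' : PeriodicConfiguration 3, Q'.energyPerParticle lennardJones :=
  siteSum_eq_of_noFractionalGain hK Q (le_eStar_of_isLeast Q hleast)

/-- The same with the hypothesis `e(Q) ≤ e*`. [folklore] -/
theorem siteSum_eq_of_noFractionalGain_of_le (hK : NoFractionalGain) (Q : PeriodicConfiguration 3)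
    (hopt : Q.energyPerParticle lennardJones ≤ ⨅ Q' : PeriodicConfiguration 3, Q'.energyPerParticle lennardJones) :
    ∀ p ∈ Q.points, ∑' q : {q : E3 // q ∈ Q.points ∧ q ≠ p}, lennardJones (dist p q.1) =
      2 * ⨅ Q' : PeriodicConfiguration 3, Q'.energyPerParticle lennardJones :=
  siteSum_eq_of_noFractionalGain_of_isLeast hK Q (isLeast_of_le_eStar Q hopt)

/-- **Under K*, optimal periodic point sets satisfy the hypotheses of M* verbatim**: `Q.points` is non-empty,
uniformly discrete, and bound by at least `2|e*|` at every site. So under K* the hypothesis class of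
`UniformBindingRigidity` contains every optimal periodic point set (and under K* ∧ M* the two classes coincide).
[folklore] -/
theorem uniformlyBound_of_noFractionalGain_of_isLeast (hK : NoFractionalGain) (Q : PeriodicConfiguration 3)
    (hleast : IsLeast (Set.range fun Q' : PeriodicConfiguration 3 => Q'.energyPerParticle lennardJones)
      (Q.energyPerParticle lennardJones)) :
    Q.points.Nonempty ∧
    (∃ δ : ℝ, 0 < δ ∧ ∀ p ∈ Q.points, ∀ q ∈ Q.points, p ≠ q → δ ≤ dist p q) ∧
    (∀ p ∈ Q.points, ∑' q : {q : E3 // q ∈ Q.points ∧ q ≠ p}, lennardJones (dist p q.1) ≤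
      2 * ⨅ Q' : PeriodicConfiguration 3, Q'.energyPerParticle lennardJones) :=
  ⟨Q.points_nonempty, Q.exists_pos_le_dist,
    fun p hp => (siteSum_eq_of_noFractionalGain_of_isLeast hK Q hleast p hp).le⟩

/-- **Under K* ∧ M*, the optimal periodic point sets are EXACTLY the non-empty uniformly discrete uniformly
`2e*`-bound sets** (M* gives `⊇`, the previous theorem `⊆`). Consequently the isolation stub of line
`perron_transfer` (countability of optimal periodic point sets modulo isometry) is the countability modulo
isometry of M*'s hypothesis class. [folklore] -/
theorem optimalPeriodic_iff_uniformlyBound (hK : NoFractionalGain) (hM : UniformBindingRigidity)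
    (X : Set E3) :
    (∃ Q : PeriodicConfiguration 3, Q.points = X ∧
      IsLeast (Set.range fun Q' : PeriodicConfiguration 3 => Q'.energyPerParticle lennardJones)
        (Q.energyPerParticle lennardJones)) ↔
    (X.Nonempty ∧ (∃ δ : ℝ, 0 < δ ∧ ∀ p ∈ X, ∀ q ∈ X, p ≠ q → δ ≤ dist p q) ∧
      ∀ p ∈ X, ∑' q : {q : E3 // q ∈ X ∧ q ≠ p}, lennardJones (dist p q.1) ≤
        2 * ⨅ Q' : PeriodicConfiguration 3, Q'.energyPerParticle lennardJones) := by
  constructor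
  · rintro ⟨Q, rfl, hleast⟩
    exact uniformlyBound_of_noFractionalGain_of_isLeast hK Q hleast
  · rintro ⟨hne, hsep, hbound⟩
    exact hM X hne hsep hbound

end Summit.AtomisticToContinuum.Crystallization.Theorems.IsometryAtomsMinimisingLawsHaveAtoms

end
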